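import Mathlib.NumberTheory.LSeries.ZetaZeros
import Mathlib.NumberTheory.LSeries.Nonvanishing
import Mathlib.Analysis.Meromorphic.Order
import Mathlib.Analysis.Meromorphic.Divisor
import Mathlib.Algebra.Order.WithTop.Untop0
import Mathlib.Analysis.SpecialFunctions.Trigonometric.Sinc
import Mathlib.Data.Set.Card
import HarnessLib

-- provenance: harness21/H21/H21/Prelude/AntSieve/ZetaZeros.lean @ ec52c55 (interim HEAD d8f2665); M5 mechanical rewrite
/-!
# Non-trivial zeros of `ζ`: orders, counting functions, ordinates

Trunk `AntSieve` (analytic number theory / sieves), prelude item C4 `ZetaZeros`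
(outline `H21/Outlines/AntSieve.md`, decision D-ANT-1). Bookkeeping for the non-trivial zeros of
the Riemann zeta function used by the `rh` statements `N(T)`, `N(σ, T)`, `N₀(T)`, `γ_n`, pair
correlation, numerical RH.

## Contents

* `Literature.riemannZetaZeroOrder ρ` : the multiplicity `m(ρ) ∈ ℤ` of `ρ` as a zero of `ζ` (the
  *pointwise* meromorphic order `meromorphicOrderAt riemannZeta ρ`, sent to `ℤ` by
  `WithTop.untop₀`; `-1` at the pole `ρ = 1`).
* `Literature.NumberTheory.LFunctions.ZetaZeros.riemannZetaNontrivialZeros` : `riemannZetaZeros` minus the trivial zeros (byte-identical to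
  the wave-0 copy `Literature.NumberTheory.LFunctions.RHWave0.riemannZetaNontrivialZeros`, so that the two can be identified by `rfl`).
* `Literature.zetaZeroBox σ T` : the zeros with `σ ≤ Re ρ ≤ 1`, `0 < Im ρ ≤ T` (finite).
* `Literature.zetaZeroCountRe σ T = N(σ, T)`, `Literature.zetaZeroCount T = N(T)`,
  `Literature.criticalZeroCount T = N₀(T)`, `Literature.simpleCriticalZeroCount T = N_s(T)`,
  `Literature.distinctZeroCount T`.
* `Literature.zetaOrdinate n = γ_n` (0-indexed ordinates of the zeros in the upper half plane, counted
  with multiplicity), `Literature.NumberTheory.LFunctions.normalizedOrdinate`, `Literature.NumberTheory.LFunctions.sineKernel`.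
* `Literature.RiemannHypothesisInStripUpTo T` : numerical RH in the two-sided strip form `|Im ρ| ≤ T`.
  The *named hypothesis* used downstream is the accepted `Literature.NumberTheory.DiophantineGeometry.RiemannHypothesisUpTo`
  (`H21/Prelude/DiophValNum/NamedHypotheses.lean`, upper half-strip `0 < Im s ≤ T`); the two are
  equivalent by `riemannZeta_conj` (`riemannHypothesisInStripUpTo_iff`, stated against the
  unfolded body of `Literature.NumberTheory.DiophantineGeometry.RiemannHypothesisUpTo` to keep the trunks import-independent).

## Mathlib

Mathlib has `riemannZetaZeros`, `IsCompact.inter_riemannZetaZeros_finite`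
(`NumberTheory/LSeries/ZetaZeros.lean`), `meromorphicOrderAt`, `MeromorphicOn.divisor`,
`differentiableAt_riemannZeta`, `riemannZeta_ne_zero_of_one_le_re`, `Real.sinc`; it has no zero
counting function, no enumeration of ordinates and no notion of non-trivial zero (beyond the
hypotheses spelled out inside `RiemannHypothesis`). Everything here is glue over those.

## Design choices

* (D-ANT-1) The order is the pointwise `meromorphicOrderAt`, **not** `MeromorphicOn.divisor`: the
  latter is `0` by definition unless a global `MeromorphicOn riemannZeta U` is supplied. The
  identification with the divisor is the lemma `riemannZetaZeroOrder_eq_divisor`, which carries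
  the meromorphy hypothesis. `untop₀` returns the junk value `0` if `ζ` were not meromorphic at
  `ρ` or identically zero near `ρ`; both are refuted from `differentiableAt_riemannZeta` and
  `riemannZeta_ne_zero_of_one_le_re` (identity theorem), see `riemannZetaZeroOrder_pos_iff`.
* Counting functions are `finsum`s of the order over the explicit box `zetaZeroBox σ T`. The
  closed conditions `Re ρ ≤ 1` and (for `σ = 0`) `0 ≤ Re ρ` add no zeros, since `ζ` has no zeros
  on `Re s = 1` (Hadamard–de la Vallée Poussin, in Mathlib) nor on `Re s = 0` (functional
  equation); `0 < Im ρ` excludes the pole and the trivial zeros. The convention `Im ρ ≤ T` makes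
  `N` right-continuous, i.e. `N(T) = N(T + 0)`.
* `zetaOrdinate n := sInf {T | n + 1 ≤ N(T)}`. This `sInf` is junk-free: the set is nonempty
  (`N` is unbounded, Hardy/Riemann–von Mangoldt), bounded below by `0` (`N(T) = 0` for `T ≤ 0`),
  and `N` is right-continuous and locally constant off the ordinates, so the infimum is attained
  and is the ordinate of a zero. No primed names (`N'`) are introduced.
* Following the shape (not the code) of PrimeNumberTheoremAnd's `ZetaDefinitions`
  (`riemannZeta.N`, `RH_up_to`).

## References

* E. C. Titchmarsh, *The Theory of the Riemann Zeta-Function*, 2nd ed. (1986), ch. 9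
  (`N(T)`, Riemann–von Mangoldt), §2.12 (non-trivial zeros lie in the open strip), §10.1 (`N₀`).
* H. L. Montgomery, *The pair correlation of zeros of the zeta function* (1973) (normalised
  ordinates, sine kernel).
* PrimeNumberTheoremAnd, `ZetaDefinitions.lean` (shape only).
-/

noncomputable section

open Complex Filter Set
open scoped Real Topology

namespace Literature.NumberTheory.LFunctions

/-! ## Order of a zero -/

/-- The multiplicity `m(ρ)` of `ρ` as a zero of the Riemann zeta function: the meromorphic order
`meromorphicOrderAt riemannZeta ρ ∈ WithTop ℤ`, sent to `ℤ` by `WithTop.untop₀`. It is `≥ 0` for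
`ρ ≠ 1`, positive exactly at the zeros, and `-1` at the simple pole `ρ = 1`.
(Titchmarsh ch. 9; outline D-ANT-1.) [folklore] -/
def riemannZetaZeroOrder (ρ : ℂ) : ℤ :=
  (meromorphicOrderAt riemannZeta ρ).untop₀

/-- For `ρ ≠ 1`, the order `m(ρ)` is positive iff `ζ(ρ) = 0`. (`ζ` is analytic at `ρ ≠ 1`,
`differentiableAt_riemannZeta`, and not identically zero near any point by the identity theorem
and `riemannZeta_ne_zero_of_one_le_re`; Titchmarsh §2.12.) [folklore] -/
theorem riemannZetaZeroOrder_pos_iff {ρ : ℂ} (h : ρ ≠ 1) :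
    0 < riemannZetaZeroOrder ρ ↔ riemannZeta ρ = 0 := by
  have ha : AnalyticAt ℂ riemannZeta ρ := analyticOn_riemannZeta ρ h
  have hne : analyticOrderAt riemannZeta ρ ≠ ⊤ := by
    intro htop
    have h2 : riemannZeta 2 = 0 :=
      analyticOn_riemannZeta.eqOn_zero_of_preconnected_of_eventuallyEq_zero
        (isConnected_compl_singleton_of_one_lt_rank (by simp) (1 : ℂ)).isPreconnected h
        (analyticOrderAt_eq_top.mp htop) (show (2 : ℂ) ∈ ({1}ᶜ : Set ℂ) by norm_num)
    exact riemannZeta_ne_zero_of_one_le_re (s := 2) (by norm_num) h2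
  obtain ⟨n, hn⟩ := ENat.ne_top_iff_exists.mp hne
  have key := ha.analyticOrderAt_eq_zero
  rw [← hn] at key
  rw [riemannZetaZeroOrder, ha.meromorphicOrderAt_eq, ← hn, ENat.map_coe, WithTop.untop₀_coe,
    Int.natCast_pos, Nat.pos_iff_ne_zero, ne_eq, ← Nat.cast_eq_zero (R := ℕ∞), key, not_not]

/-- For `ρ ≠ 1`, the order `m(ρ)` is non-negative (`ζ` is holomorphic away from `1`;
`differentiableAt_riemannZeta`). [folklore] -/
theorem riemannZetaZeroOrder_nonneg {ρ : ℂ} (h : ρ ≠ 1) : 0 ≤ riemannZetaZeroOrder ρ :=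
  WithTop.untop₀_nonneg.2 (analyticOn_riemannZeta ρ h).meromorphicOrderAt_nonneg

/-- `ζ` has a simple pole at `s = 1`: `m(1) = -1` (`riemannZeta_residue_one`; Titchmarsh §2.1). [cite: Titchmarsh1986, §2.1] -/
def riemannZetaZeroOrder_one : Prop :=
  riemannZetaZeroOrder 1 = -1

/-- On any set `U` on which `ζ` is known to be meromorphic, `m(ρ)` agrees with Mathlib's divisor
`MeromorphicOn.divisor riemannZeta U` (by `MeromorphicOn.divisor_apply`; outline D-ANT-1). [folklore] -/
theorem riemannZetaZeroOrder_eq_divisor {U : Set ℂ} {ρ : ℂ} (hU : MeromorphicOn riemannZeta U)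
    (hρ : ρ ∈ U) : riemannZetaZeroOrder ρ = MeromorphicOn.divisor riemannZeta U ρ := by
  rw [MeromorphicOn.divisor_apply hU hρ, riemannZetaZeroOrder]

/-- Conjugation symmetry of the multiplicities, `m(ρ̄) = m(ρ)` (from `riemannZeta_conj`;
Titchmarsh §2.12). [cite: Titchmarsh1986, §2.12] -/
def riemannZetaZeroOrder_conj : Prop :=
  ∀ (ρ : ℂ),
    riemannZetaZeroOrder (starRingEnd ℂ ρ) = riemannZetaZeroOrder ρ

/-- Functional-equation symmetry of the multiplicities in the critical strip: for
`0 < Re ρ < 1`, `m(1 - ρ) = m(ρ)` (no zero hypothesis is needed; from `riemannZeta_one_sub` and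
the non-vanishing of the `Γ`/cosine factor in the strip; Titchmarsh §2.12). [cite: Titchmarsh1986, §2.12] -/
def riemannZetaZeroOrder_one_sub : Prop :=
  ∀ {ρ : ℂ} (h₀ : 0 < ρ.re) (h₁ : ρ.re < 1),
    riemannZetaZeroOrder (1 - ρ) = riemannZetaZeroOrder ρ

/-! ## Non-trivial zeros -/

/-- The set of non-trivial zeros of `ζ`: Mathlib's `riemannZetaZeros` minus the trivial zeros
`-2(n+1)`, `n : ℕ`. (Mathlib's `RiemannHypothesis` additionally excludes `s = 1`, which is
redundant by `riemannZeta_one_ne_zero`.) By `riemannZeta_ne_zero_of_one_le_re` and the functional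
equation these all lie in the open strip `0 < Re s < 1` (Hadamard–de la Vallée Poussin; Titchmarsh
§2.12); we do not build that into the definition, see `mem_riemannZetaNontrivialZeros_iff`.
The body is byte-identical to `Literature.NumberTheory.LFunctions.RHWave0.riemannZetaNontrivialZeros` (`Statements/RH/Wave0`). [folklore] -/
def ZetaZeros.riemannZetaNontrivialZeros : Set ℂ :=
  riemannZetaZeros \ Set.range (fun n : ℕ ↦ (-2 * (n + 1) : ℂ))

/-- The non-trivial zeros of `ζ` are exactly the zeros in the open critical strip
`0 < Re ρ < 1` (Hadamard, de la Vallée Poussin 1896 for `Re ρ < 1`, i.e.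
`riemannZeta_ne_zero_of_one_le_re`; the functional equation `riemannZeta_one_sub` for `0 < Re ρ`;
Titchmarsh §2.12). [cite: Poussin1896, for  Re ρ < 1   i.e.  riemannZeta_ne_zer] -/
def mem_riemannZetaNontrivialZeros_iff : Prop :=
  ∀ {ρ : ℂ},
    ρ ∈ ZetaZeros.riemannZetaNontrivialZeros ↔ riemannZeta ρ = 0 ∧ 0 < ρ.re ∧ ρ.re < 1

/-! ## Boxes of zeros and counting functions -/

/-- The zeros of `ζ` in the box `σ ≤ Re ρ ≤ 1`, `0 < Im ρ ≤ T` (each zero listed once; the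
multiplicity is `riemannZetaZeroOrder`). Since `ζ ≠ 0` on `Re s = 1`
(`riemannZeta_ne_zero_of_one_le_re`) and on `Re s = 0` (functional equation), the closed
conditions `Re ρ ≤ 1`, `0 ≤ Re ρ` add nothing; `0 < Im ρ` excludes the pole `1` and the trivial
zeros. Finite by `zetaZeroBox_finite`. (Titchmarsh §9.1.) [folklore] -/
def zetaZeroBox (σ T : ℝ) : Set ℂ :=
  {ρ | riemannZeta ρ = 0 ∧ σ ≤ ρ.re ∧ ρ.re ≤ 1 ∧ 0 < ρ.im ∧ ρ.im ≤ T}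

/-- The box `zetaZeroBox σ T` is finite: it lies in the compact rectangle
`[σ, 1] × [0, T]` and the zeros of `ζ` are discrete (`IsCompact.inter_riemannZetaZeros_finite`). [folklore] -/
theorem zetaZeroBox_finite (σ T : ℝ) : (zetaZeroBox σ T).Finite := by
  refine ((isCompact_Icc (a := σ) (b := 1)).reProdIm
    (isCompact_Icc (a := 0) (b := T))).inter_riemannZetaZeros_finite.subset ?_
  rintro ρ ⟨h0, h1, h2, h3, h4⟩
  exact ⟨Complex.mem_reProdIm.2 ⟨⟨h1, h2⟩, ⟨h3.le, h4⟩⟩, h0⟩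

/-- Every zero in a box `zetaZeroBox σ T` is a non-trivial zero (it has positive imaginary part,
whereas the trivial zeros are real). [folklore] -/
theorem zetaZeroBox_subset_riemannZetaNontrivialZeros (σ T : ℝ) :
    zetaZeroBox σ T ⊆ ZetaZeros.riemannZetaNontrivialZeros := by
  rintro ρ ⟨h0, -, -, h3, -⟩
  refine ⟨h0, ?_⟩
  rintro ⟨n, rfl⟩
  simp at h3

/-- `N(σ, T)`: the number of zeros `ρ = β + iγ` of `ζ`, counted with multiplicity, with
`σ ≤ β ≤ 1` and `0 < γ ≤ T` — the `finsum` of `riemannZetaZeroOrder` over `zetaZeroBox σ T`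
(a sum of positive integers, `riemannZetaZeroOrder_pos_iff`), read in `ℕ`.
(Titchmarsh §9.15; Ingham 1940.) [cite: Ingham1940] -/
def zetaZeroCountRe (σ T : ℝ) : ℕ :=
  (∑ᶠ ρ ∈ zetaZeroBox σ T, riemannZetaZeroOrder ρ).toNat

/-- `N(T)`: the number of zeros `ρ = β + iγ` of `ζ` with `0 < γ ≤ T`, counted with multiplicity
(`= zetaZeroCountRe 0 T`; the strip is `0 < β < 1` automatically). Right-continuous in `T`.
(Riemann 1859; von Mangoldt 1905; Titchmarsh §9.1.) [cite: Riemann1859] -/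
def zetaZeroCount (T : ℝ) : ℕ :=
  zetaZeroCountRe 0 T

/-- `N₀(T)`: the number of zeros of `ζ` on the critical line `Re ρ = 1/2` with `0 < Im ρ ≤ T`,
counted with multiplicity. (Hardy–Littlewood 1921; Selberg 1942; Titchmarsh §10.1.) [cite: HardyLittlewood1921] -/
def criticalZeroCount (T : ℝ) : ℕ :=
  (∑ᶠ ρ ∈ {ρ ∈ zetaZeroBox (1 / 2) T | ρ.re = 1 / 2}, riemannZetaZeroOrder ρ).toNat

/-- `N_s(T)` (also `N₀^*(T)`): the number of *simple* zeros of `ζ` on the critical line with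
`0 < Im ρ ≤ T`. (Levinson 1974; Conrey 1989; Titchmarsh §10.1.) [cite: Levinson1974] -/
def simpleCriticalZeroCount (T : ℝ) : ℕ :=
  {ρ ∈ zetaZeroBox (1 / 2) T | ρ.re = 1 / 2 ∧ riemannZetaZeroOrder ρ = 1}.ncard

/-- The number of *distinct* zeros of `ζ` with `0 < Im ρ ≤ T` (no multiplicity):
`Set.ncard (zetaZeroBox 0 T)`. (Titchmarsh §9.1; Montgomery 1973.) [cite: Montgomery1973] -/
def distinctZeroCount (T : ℝ) : ℕ :=
  (zetaZeroBox 0 T).ncard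

/-- `N(σ, T)` is non-decreasing in `T`. [cite: Titchmarsh1986, §9.1] -/
def zetaZeroCountRe_mono_right : Prop :=
  ∀ (σ : ℝ),
    Monotone (zetaZeroCountRe σ)

/-- `N(σ, T)` is non-increasing in `σ`. [cite: Titchmarsh1986, §9.1] -/
def zetaZeroCountRe_anti_left : Prop :=
  ∀ (T : ℝ),
    Antitone (zetaZeroCountRe · T)

/-- `N₀(T) ≤ N(T)`: the critical zeros are among all zeros (outline: `criticalZeroCount_le`). [cite: Titchmarsh1986, §9.1] -/
def criticalZeroCount_le_zetaZeroCount : Prop :=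
  ∀ (T : ℝ),
    criticalZeroCount T ≤ zetaZeroCount T

/-- `N(T) → ∞` as `T → ∞`: `ζ` has infinitely many non-trivial zeros (Riemann–von Mangoldt
`N(T) ~ (T / 2π) log T`, Titchmarsh Thm. 9.4; already Hardy 1914 gives infinitely many on the
critical line). [cite: Hardy1914, gives infinitely many on the critical li] -/
def tendsto_zetaZeroCount_atTop : Prop :=
  Tendsto zetaZeroCount atTop atTop

/-! ## Ordinates -/

/-- `γ_n`, the `n`-th ordinate (0-indexed, non-decreasing, repeated according to multiplicity) of
the zeros of `ζ` in the upper half plane: `γ_n = inf {T | n + 1 ≤ N(T)}`. The `sInf` is attained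
and junk-free: the set is nonempty (`tendsto_zetaZeroCount_atTop`), bounded below by `0`
(`N(T) = 0` for `T ≤ 0`), and `N` is right-continuous. So `γ_0 = γ_1 = ⋯ ≈ 14.1347…` repeated
`m(ρ_1)` times, etc. (Titchmarsh §9.1; Montgomery 1973.) [cite: Montgomery1973] -/
def zetaOrdinate (n : ℕ) : ℝ :=
  sInf {T | n + 1 ≤ zetaZeroCount T}

/-- Bridge between the counting function and the enumeration:
`N(T) = #{n | γ_n ≤ T}` (Titchmarsh §9.1). Junk-free: `{n | γ_n ≤ T}` is finite for every `T`.
(Bridge name fixed by the outline, D-ANT-1.) [cite: Titchmarsh1986, §9.1] -/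
def zetaZeroCount_eq_ncard : Prop :=
  ∀ (T : ℝ),
    zetaZeroCount T = {n | zetaOrdinate n ≤ T}.ncard

/-- The ordinates `γ_n` are non-decreasing in `n`. [cite: Titchmarsh1986, §9.1] -/
def zetaOrdinate_mono : Prop :=
  Monotone zetaOrdinate

/-- Every ordinate is positive, `0 < γ_n` (indeed `γ_n > 14`; `ζ` has no zeros with
`0 < Re s < 1` on the real axis, Titchmarsh §2.12). [cite: Titchmarsh1986, §2.12 (no real zeros in the strip)] -/
def zetaOrdinate_pos : Prop :=
  ∀ (n : ℕ),
    0 < zetaOrdinate n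

/-- Each `γ_n` is the ordinate of a zero: there is `σ` (with `0 < σ < 1`) such that
`ζ(σ + iγ_n) = 0`. (Titchmarsh §9.1.) [cite: Titchmarsh1986, §9.1] -/
def exists_zero_of_zetaOrdinate : Prop :=
  ∀ (n : ℕ),
    ∃ σ : ℝ, 0 < σ ∧ σ < 1 ∧ riemannZeta (σ + zetaOrdinate n * I) = 0

/-- The first zero has ordinate `γ_0 = 14.134725… > 14` (Gram 1903; Titchmarsh §15.1; rigorous:
Platt–Trudgian 2021). (Outline: `zetaOrdinate_zero_gt`.) [cite: Gram1903] -/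
def fourteen_lt_zetaOrdinate_zero : Prop :=
  14 < zetaOrdinate 0

/-- Montgomery's normalised ordinates `γ̃_n = γ_n log(γ_n) / (2π)`, which have mean spacing `1`
(Montgomery 1973; Odlyzko 1987). [cite: Montgomery1973] -/
def normalizedOrdinate (n : ℕ) : ℝ :=
  zetaOrdinate n * Real.log (zetaOrdinate n) / (2 * π)

/-- The sine kernel `sin(πx) / (πx)` (value `1` at `0`, via `Real.sinc`) of the GUE pair
correlation `1 - sineKernel(x)^2` (Montgomery 1973; Dyson). [cite: Montgomery1973] -/
def sineKernel (x : ℝ) : ℝ :=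
  Real.sinc (π * x)

/-! ## Numerical RH (strip form) -/

/-- The Riemann Hypothesis up to height `T`, two-sided strip form: every zero of `ζ` in the open
critical strip with `|Im ρ| ≤ T` lies on the critical line (shape of PrimeNumberTheoremAnd's
`RH_up_to`; e.g. Platt–Trudgian, *Bull. LMS* 53 (2021), Thm. 1: true for `T = 3 · 10^{12}`).
The named hypothesis consumed by H21 statements is the accepted `Literature.NumberTheory.DiophantineGeometry.RiemannHypothesisUpTo`
(`H21/Prelude/DiophValNum/NamedHypotheses.lean`, upper half-strip `0 < Im s ≤ T`), which is
equivalent (`riemannHypothesisInStripUpTo_iff`); this variant is kept under a distinct name only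
as the strip-shaped reformulation. [folklore] -/
def RiemannHypothesisInStripUpTo (T : ℝ) : Prop :=
  ∀ ρ : ℂ, riemannZeta ρ = 0 → 0 < ρ.re → ρ.re < 1 → |ρ.im| ≤ T → ρ.re = 1 / 2

/-- The strip form `RiemannHypothesisInStripUpTo T` is equivalent to the upper-half-strip form
`∀ s, ζ s = 0 → 0 < Im s → Im s ≤ T → Re s = 1/2`, which is by definition
`Literature.RiemannHypothesisUpTo T` of `H21/Prelude/DiophValNum/NamedHypotheses.lean` (spelled out here
so that this file does not import the DiophValNum trunk). Proof: `riemannZeta_conj` for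
`Im s < 0`; zeros with `Im s ≠ 0` are non-trivial hence in the open strip
(`mem_riemannZetaNontrivialZeros_iff`); and `ζ` has no real zeros in `(0, 1)`
(Titchmarsh §2.12). [cite: Titchmarsh1986, §2.12] -/
def riemannHypothesisInStripUpTo_iff : Prop :=
  ∀ (T : ℝ),
    RiemannHypothesisInStripUpTo T ↔
      ∀ s : ℂ, riemannZeta s = 0 → 0 < s.im → s.im ≤ T → s.re = 1 / 2

end Literature.NumberTheory.LFunctions

end
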